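import Mathlib
import Summits.Ventures.PercRepro2.PMK5Deg5LocusPat

/-!
# THE CRUX FUNCTIONAL AT THE CENTRE OF A FACE OF `K₆` IS A SIGNED SUM OF PRODUCTS OF THREE CONFIGURATION
COUNTS (blind cell PercRepro2, mine-2 g32; the zero side of the equality locus)

At the centre `½ · 1_M` of the face of an edge set `M`, every configuration supported on `M` has the same weight
`c_M = 2^{−|M|}` and every other configuration weight `0` (`weight_centre`); so the cubic form `hcov_cubic`
`Gc = Σ_{x,y,z} P(x) P(y) P(z) K₃(x,y,z)` FACTORISES monomial by monomial: with `K₃` the signed sum of twenty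
products of the nineteen tables (`Deg5Tables.K3_apply`), **`gc15_centre_eq`** —
`Gc (centre M) ends15 0 1 2 5 4 = c_M³ · (KposV (cntV M) − KnegV (cntV M))`, where `cntV M i = cnt1 (tab i) M`
counts the configurations `ω ⊆ M` with `tab i ω` (the tree `go1`, `2^|M|` leaves; `cnt1_eq`: the tree is the
filtered sum) and `KposV` / `KnegV` are the ten positive / ten negative monomials of `K₃` evaluated on the counts.
Hence **`gc15_centre_zero`**: `KposV (cntV M) = KnegV (cntV M)` (one kernel computation of nineteen counts per
face) makes `Gc` vanish at the centre of `M`, and with `gc15_zero_of_centre` on the whole face.  Standard axioms.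
-/

namespace Summit.Ventures.PercRepro2

open Hub CovForm

namespace Deg5

namespace Locus

/-! ## The configuration count tree -/

/-- The count tree: on the edges `< n` branch on the state of the edge (open only if it lies in `M`); at a leaf
evaluate the table. -/
def go1 (T : (Fin 15 → Bool) → Bool) (M : ℕ) : ℕ → (Fin 15 → Bool) → ℕ
  | 0, ω => (T ω).toNat
  | n + 1, ω => go1 T M n (Function.update ω (Fin.ofNat 15 n) false) +
      (if M.testBit n then go1 T M n (Function.update ω (Fin.ofNat 15 n) true) else 0)

/-- The number of configurations `ω ⊆ M` with `T ω`, by the tree. -/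
def cnt1 (T : (Fin 15 → Bool) → Bool) (M : ℕ) : ℕ := go1 T M 15 (fun _ => false)

/-- The configurations supported on `M` on the edges `< n`. -/
def SubLt (n M : ℕ) (s : Fin 15 → Bool) : Prop := ∀ e : Fin 15, (e : ℕ) < n → s e = true → M.testBit e = true

/-- `SubLt` is decidable. -/
instance (n M : ℕ) (s : Fin 15 → Bool) : Decidable (SubLt n M s) := by
  unfold SubLt; infer_instance

/-- The configurations agreeing with `ω` on the edges `≥ n` and supported on `M` on the edges `< n`. -/
def S1 (n M : ℕ) (ω : Fin 15 → Bool) : Finset (Fin 15 → Bool) :=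
  Finset.univ.filter fun s => AgreeGe n ω s ∧ SubLt n M s

/-- The fibre of `S1 (n + 1)` over the state `a` of the edge `n`. -/
lemma S1_succ_fibre {n : ℕ} (hn : n < 15) (M : ℕ) (ω : Fin 15 → Bool) (a : Bool) :
    (S1 (n + 1) M ω).filter (fun s => s (Fin.ofNat 15 n) = a) =
      if a = true ∧ M.testBit n = false then ∅ else S1 n M (Function.update ω (Fin.ofNat 15 n) a) := by
  ext s
  simp only [S1, Finset.mem_filter, Finset.mem_univ, true_and]
  split_ifs with hc
  · simp only [Finset.notMem_empty, iff_false, not_and]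
    rintro ⟨-, h2⟩ hs
    have := h2 (Fin.ofNat 15 n) (by rw [ofNat_val hn]; omega) (by rw [hs, hc.1])
    rw [ofNat_val hn, hc.2] at this
    exact absurd this (by decide)
  · simp only [Finset.mem_filter, Finset.mem_univ, true_and]
    rw [← agree_succ_iff hn ω s a]
    constructor
    · rintro ⟨⟨h1, h2⟩, hs⟩
      exact ⟨⟨h1, hs⟩, fun e he => h2 e (by omega)⟩
    · rintro ⟨⟨h1, hs⟩, h2⟩
      refine ⟨⟨h1, fun e he hse => ?_⟩, hs⟩
      rcases Nat.lt_succ_iff_lt_or_eq.1 he with he | he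
      · exact h2 e he hse
      · have hen : e = Fin.ofNat 15 n := Fin.ext (by rw [ofNat_val hn, he])
        rw [hen, hs] at hse
        rw [he]
        rcases Bool.eq_false_or_eq_true (M.testBit n) with hM | hM
        · exact hM
        · exact absurd ⟨hse, hM⟩ hc

/-- **The invariant of the count tree**: `go1 T M n ω` is the sum of `T` over `S1 n M ω`. -/
theorem go1_eq (T : (Fin 15 → Bool) → Bool) (M : ℕ) :
    ∀ (n : ℕ), n ≤ 15 → ∀ ω : Fin 15 → Bool, go1 T M n ω = ∑ s ∈ S1 n M ω, (T s).toNat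
  | 0, _, ω => by
    have hS : S1 0 M ω = {ω} := by
      ext s
      simp only [S1, Finset.mem_filter, Finset.mem_univ, true_and, Finset.mem_singleton, AgreeGe, SubLt,
        Nat.zero_le, true_implies, Nat.not_lt_zero, false_implies, implies_true, and_true]
      exact ⟨fun h => funext h, fun h e => by rw [h]⟩
    rw [hS, Finset.sum_singleton]
    rfl
  | n + 1, hn, ω => by
    have hn' : n < 15 := by omega
    have hf : (S1 (n + 1) M ω).filter (fun s : Fin 15 → Bool => ¬ s (Fin.ofNat 15 n) = true) =
        (S1 (n + 1) M ω).filter (fun s : Fin 15 → Bool => s (Fin.ofNat 15 n) = false) := by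
      apply Finset.filter_congr
      intro s _
      simp only [Bool.not_eq_true]
    rw [go1, ← Finset.sum_filter_add_sum_filter_not (S1 (n + 1) M ω)
      (fun s : Fin 15 → Bool => s (Fin.ofNat 15 n) = true), hf, S1_succ_fibre hn' M ω true,
      S1_succ_fibre hn' M ω false, go1_eq T M n (by omega), go1_eq T M n (by omega)]
    rcases Bool.eq_false_or_eq_true (M.testBit n) with hM | hM <;> simp [hM, add_comm]

/-- The configurations supported on `M`. -/
def Sub (M : ℕ) (s : Fin 15 → Bool) : Prop := ∀ e : Fin 15, s e = true → M.testBit e = true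

/-- `Sub` is decidable. -/
instance (M : ℕ) (s : Fin 15 → Bool) : Decidable (Sub M s) := by
  unfold Sub; infer_instance

/-- **The tree is the filtered sum**: `cnt1 T M = Σ_{ω ⊆ M} T ω`. -/
theorem cnt1_eq (T : (Fin 15 → Bool) → Bool) (M : ℕ) :
    cnt1 T M = ∑ s ∈ Finset.univ.filter (Sub M), (T s).toNat := by
  unfold cnt1
  rw [go1_eq T M 15 le_rfl]
  apply Finset.sum_congr
  · ext s
    simp only [S1, Finset.mem_filter, Finset.mem_univ, true_and, AgreeGe, SubLt, Sub]
    constructor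
    · rintro ⟨-, h2⟩ e
      exact h2 e e.isLt
    · intro h
      exact ⟨fun e he => absurd he (by omega), fun e _ => h e⟩
  · intros; rfl

/-! ## The weight of a configuration at the centre of a face -/

section Centre

variable {R : Type*} [Field R] [LinearOrder R] [IsStrictOrderedRing R]

/-- The common weight `2^{−|M|}` of the configurations supported on `M` at the centre of `M`. -/
def cM (M : ℕ) : R := ∏ e : Fin 15, (if M.testBit e = true then (1 / 2 : R) else 1)

/-- **The weight at the centre**: `c_M` on the configurations supported on `M`, `0` elsewhere. -/
lemma weight_centre (M : ℕ) (s : Fin 15 → Bool) :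
    weight (centre (R := R) M) s = if Sub M s then cM M else 0 := by
  unfold weight cM
  split_ifs with hs
  · refine Finset.prod_congr rfl fun e _ => ?_
    rcases Bool.eq_false_or_eq_true (M.testBit e) with h | h
    · rw [centre_on h, if_pos h]
      cases s e <;> norm_num [edgeFactor]
    · rw [centre_off h, if_neg (by simp [h])]
      have hse : s e = false := by
        rcases Bool.eq_false_or_eq_true (s e) with h' | h'
        · rw [hs e h'] at h
          exact absurd h (by decide)
        · exact h'
      rw [hse]
      simp [edgeFactor]
  · have hex : ∃ e : Fin 15, s e = true ∧ M.testBit e = false := by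
      by_contra hne
      apply hs
      intro e hse
      rcases Bool.eq_false_or_eq_true (M.testBit e) with h | h
      · exact h
      · exact absurd ⟨e, hse, h⟩ hne
    obtain ⟨e, hse, hMe⟩ := hex
    apply Finset.prod_eq_zero (Finset.mem_univ e)
    rw [centre_off hMe, hse]
    simp [edgeFactor]

/-- A Bernstein-1 form of a table at the centre of `M` is `c_M` times the count of `M`. -/
lemma bform_centre (M : ℕ) (T : (Fin 15 → Bool) → Bool) :
    bform (centre (R := R) M) (indR T) = cM M * ((cnt1 T M : ℕ) : R) := by
  unfold bform
  rw [cnt1_eq, Nat.cast_sum, Finset.mul_sum, Finset.sum_filter]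
  refine Finset.sum_congr rfl fun s _ => ?_
  rw [weight_centre]
  split_ifs
  · unfold indR
    cases T s <;> simp
  · simp

end Centre

/-! ## The cubic form of `K₃` as a signed sum of products of Bernstein-1 forms -/

section Cubic

variable {R : Type*} [Field R] [LinearOrder R] [IsStrictOrderedRing R]

omit [LinearOrder R] [IsStrictOrderedRing R] in
/-- The triple sum of a product of three tables factorises. -/
lemma triple_bform (p : Fin 15 → R) (T₁ T₂ T₃ : (Fin 15 → Bool) → Bool) :
    ∑ x : Fin 15 → Bool, ∑ y : Fin 15 → Bool, ∑ z : Fin 15 → Bool,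
      weight p x * weight p y * weight p z * (indR T₁ x * indR T₂ y * indR T₃ z) =
      bform p (indR T₁) * bform p (indR T₂) * bform p (indR T₃) := by
  rw [bform_mul_mul_eq_sum]
  simp only [Fintype.sum_prod_type]

/-- The ten positive monomials of `K₃` on a vector of nineteen values. -/
def KposV (c : Fin 19 → ℕ) : ℕ := (Deg3.posMonos.map fun P => c P.1 * c P.2.1 * c P.2.2).sum

/-- The ten negative monomials of `K₃` on a vector of nineteen values. -/
def KnegV (c : Fin 19 → ℕ) : ℕ := (Deg3.negMonos.map fun P => c P.1 * c P.2.1 * c P.2.2).sum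

/-- The nineteen configuration counts of the face `M`. -/
def cntV (M : ℕ) : Fin 19 → ℕ := fun i => cnt1 (tab i) M

/-- **The crux functional at the centre of `M`** as a signed sum of products of three configuration counts. -/
theorem gc15_centre_eq (M : ℕ) :
    Gc (centre (R := R) M) ends15 0 1 2 5 4 =
      cM M ^ 3 * (((KposV (cntV M) : ℕ) : R) - ((KnegV (cntV M) : ℕ) : R)) := by
  rw [hcov_cubic (centre (R := R) M) ends15 0 1 2 5 4 (fun _ => 0), triSum_empty]
  have hK : CovForm.K3 (R := R) ends15 0 1 2 5 4 = fun a b c =>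
      (indR tPD a * indR tQ b * indR (t4p) c + indR tQ a * indR tPDoU b * indR (t5p) c +
        indR tPD a * indR tQ b * indR (t6m) c +
        indR tPD a * indR (t7p 4) b * indR (t7m 0) c + indR tPD a * indR (t7m 4) b * indR (t7p 0) c +
        indR tPDoU a * indR (t7p 4) b * indR (t7m 5) c + indR tPDoU a * indR (t7m 4) b * indR (t7p 5) c +
        indR tPD a * indR (t7p 4) b * indR (t10p) c + indR tPD a * indR (t7m 4) b * indR (t10m) c +
        indR tQ a * indR (t12) b * indR tPDoU c) -
      (indR tPD a * indR tQ b * indR (t4m) c + indR tQ a * indR tPDoU b * indR (t5m) c +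
        indR tPD a * indR tQ b * indR (t6p) c +
        indR tPD a * indR (t7p 4) b * indR (t7p 0) c + indR tPD a * indR (t7m 4) b * indR (t7m 0) c +
        indR tPDoU a * indR (t7p 4) b * indR (t7p 5) c + indR tPDoU a * indR (t7m 4) b * indR (t7m 5) c +
        indR tPD a * indR (t7p 4) b * indR (t10m) c + indR tPD a * indR (t7m 4) b * indR (t10p) c +
        indR tPD a * indR tQ b * indR (t11) c) := by
    funext a b c
    exact K3_apply a b c
  rw [hK]
  simp only [mul_sub, mul_add, Finset.sum_sub_distrib, Finset.sum_add_distrib, triple_bform, bform_centre]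
  simp only [KposV, KnegV, cntV, Deg3.posMonos, Deg3.negMonos, List.map_cons, List.map_nil, List.sum_cons,
    List.sum_nil, add_zero, tab0, tab1, tab2, tab3, tab4, tab5, tab6, tab7, tab8, tab9, tab10, tab11, tab12,
    tab13, tab14, tab15, tab16, tab17, tab18]
  push_cast
  ring

/-- **The zero side from the counts**: equal positive and negative monomial sums at the centre of `M` make `Gc`
vanish there. -/
theorem gc15_centre_zero (M : ℕ) (h : KposV (cntV M) = KnegV (cntV M)) :
    Gc (centre (R := R) M) ends15 0 1 2 5 4 = 0 := by
  rw [gc15_centre_eq, h, sub_self, mul_zero]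

end Cubic

end Locus

end Deg5

end Summit.Ventures.PercRepro2
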